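import Summits.HodgeConjecture.HodgeConjecture.Theorems.F0P3cStCharTSJacCartanWeightDock     -- ★ WEIGHT-DOCK 2∕2 `tubeJacobianLocal_cartan_Gqs_elliptic` (LH6-p04 g7): (E4)'s `hJac` at a compact Cartan (brings ★ C8b-model p852303, ★ Q9-CM p852024)
import Summits.HodgeConjecture.HodgeConjecture.Theorems.F0P3cStCharTSWeylHypMeasure          -- ★ `exists_conjFamily`
import Summits.HodgeConjecture.HodgeConjecture.Theorems.F0P3cStCharTSWeylCartanRadial         -- ★ `mul_comm_of_mem_centralizer`
import HarnessLib

/-!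
# F0 · P3c · line LH6 «StCharTS» — ROAD «JAC-ELL» C8 TERMINUS: the compact-Cartan tube-Jacobian socket `hJacT` of ★ «WIF AT THE DATUM PINS» (p852335), IN ITS SIGNED LETTERS
# (Φ-free set-builder tube, every Haar torus measure, weight `√(∏_w |disc χ_t|_w (∏_w |det t|_w)⁻²)`) — UNCONDITIONAL (Harish-Chandra 1970 Lemma 22; Rogawski 1990 §12.5 p. 182)

Cell `pub/hodgecm-mathlib`, crux H413 = `stmt-HodgeConjecture-24833` (lane `--supports … --as helper`); seat LH5-p02 (g7), holder of road «JAC-ELL» (C1–C8, Q1–Q11; head ★ p852303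
`tubeJacobianLocal_elliptic_model`).  THEOREMS ONLY; sorry-free; no definition ∕ instance ∕ notation ∕ named fact; ★-only imports; axioms TRIO.

THE POINT.  ★ p852335 `F0P3cStCharTSWeylDatumPinsWIF.weylIntegrationFormula_of_datumPins` proves the (S-𝔇) block antecedent `hWIF` from the datum pins modulo ONE named input, the
compact-Cartan socket `hJacT` (letters signed 2026-09-02T18:06Z, sigsheet 158545636702c2e4).  This file proves `hJacT` — **`tubeJacobianSocket_compactCartan L v hns ν`** has EXACTLY
the letter's type — so the junction∕RUNG0 pen deletes the binder by ONE token.  PROOF: ★ WEIGHT-DOCK 2∕2 `tubeJacobianLocal_cartan_Gqs_elliptic` (LH6-p04 (g7): ★ C8b-model ∘ ★ Q9-CM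
with the model-side inputs constructed and `hDlc`∕`hDval` discharged by ★ WEIGHT-DOCK 1∕2 p852323) at the place `w ∣ v` (Mathlib `Nonempty (PlacesOver L v)`, fixed by `c̄` by `hns`),
the conjugation family `Φ` of the abelian `T = Z(γ₀)` (★ `exists_conjFamily` ∘ ★ `mul_comm_of_mem_centralizer`), the socket's instance classes from `tT.IsHaarMeasure`, the closedness
witness `hTcpt.isClosed`, and the two-line identity `Φ '' (A₀ ×ˢ V) = {x t x⁻¹ | x̄ ∈ A₀, t ∈ V}`.
HONEST LABEL: count-neutral; with ★ p852335 the organ's printed «WIF» [R90 §12.5 p. 182] is reached in-house (junction v7 ∕ RUNG0 v6 fold, pen LH6-p01); closes no organ by itself.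
HC_CM is proved only modulo the 7 printed citations (2 remaining: hLiu418 = `stmt-HodgeConjecture-24832`, h413 = `stmt-HodgeConjecture-24833`) until rung 0 closes.

## References
* [HarishChandra1970] Harish-Chandra (notes by G. van Dijk), *Harmonic analysis on reductive p-adic groups*, LNM 162 (1970), Part V §4 Lemma 22.
* [Rogawski1990] J. D. Rogawski, *Automorphic Representations of Unitary Groups in Three Variables*, Ann. of Math. Stud. 123 (1990), §12.5 p. 182; §3.6 p. 29; §4.9 p. 54.
-/

set_option autoImplicit false
-- the mandated namespace has the single-problem summit's repeated segment (`HodgeConjecture.HodgeConjecture`)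
set_option linter.dupNamespace false

noncomputable section

open MeasureTheory Measure Set Filter Topology Function NumberField IsDedekindDomain
open Literature.MeasureTheory.Group
open Literature.NumberTheory.Automorphic Literature.NumberTheory.Automorphic.UnitaryGroup Literature.NumberTheory.Rogawski1990
open Summit.HodgeConjecture.HodgeConjecture.Cruxes.H413
open Summit.HodgeConjecture.HodgeConjecture.Cruxes.H413.F0P3cStCharTSWeylHypMeasure
open Summit.HodgeConjecture.HodgeConjecture.Cruxes.H413.F0P3cStCharTSWeylCartanRadial
open Summit.HodgeConjecture.HodgeConjecture.Cruxes.H413.F0P3cStCharTSJacCartanWeightDock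
open scoped ENNReal NNReal MatrixGroups Pointwise

namespace Summit.HodgeConjecture.HodgeConjecture.Cruxes.H413.F0P3cStCharTSJacCartanTerminus

section CM

variable (L : Type) [Field L] [NumberField L] [IsCMField L] (v : HeightOneSpectrum (𝓞 ↥(maximalRealSubfield L)))

set_option maxHeartbeats 1600000 in
set_option synthInstance.maxHeartbeats 400000 in
-- long socket statement (class of ★ ADAPTER-M ∕ ★ (J6) FILE 6)
/-- **JAC-ELL C8 TERMINUS — the compact-Cartan tube-Jacobian socket, in the signed letters.**  `G = Gqs L v = U(Φ₃)(L⁺_v)`, `v` non-split (`hns`), `ν` a Haar measure.  For every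
subgroup `T = Z(γ₀)` with `γ₀` regular and `T` COMPACT, every Haar measure `tT` of `T` with inversion symmetry and `tT (compactCore T) = 1` (Borel σ-algebra on `G ⧸ T`): every
regular `t₀ ∈ T` has an open `U ∋ t₀` and a Borel `A₀ ⊆ G ⧸ T` with `0 < (ν∕tT)(A₀) < ∞` such that for all Borel regular `W`-free `V ⊆ U`,
`ν {x t x⁻¹ | x̄ ∈ A₀, t ∈ V} = (ν∕tT)(A₀) · ∫⁻_V √(∏_w |disc χ_t|_w (∏_w |det t|_w)⁻²) dtT` — the `hJacT` binder of ★ p852335 with `νQv ↦ ν`, token for token.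
[cite: HarishChandra1970, Lemma 22] [cite: Rogawski1990, §12.5 p. 182; §3.6 p. 29; §4.9 p. 54] -/
theorem tubeJacobianSocket_compactCartan
    (hns : ∀ w : PlacesOver L v, IsCMField.complexConj L • w.1 = w.1)
    [MeasurableSpace (Gqs L v)] [BorelSpace (Gqs L v)] [LocallyCompactSpace (Gqs L v)] [SecondCountableTopology (Gqs L v)] [T2Space (Gqs L v)]
    (ν : Measure (Gqs L v)) [ν.IsHaarMeasure] [ν.IsMulRightInvariant] :
    ∀ (T : Subgroup (Gqs L v)) (γ₀ : Gqs L v) (_ : IsRegularElt (γ₀.val : GL (Fin 3) (UnitaryGroup.LocalRing L v)))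
      (_ : T = Subgroup.centralizer ({γ₀} : Set (Gqs L v))) (hTcpt : IsCompact (T : Set (Gqs L v))),
      (letI : MeasurableSpace (Gqs L v ⧸ T) := borel _; haveI : BorelSpace (Gqs L v ⧸ T) := ⟨rfl⟩;
      ∀ (tT : Measure ↥T) (_ : tT.IsHaarMeasure) (_ : tT.IsInvInvariant), tT (compactCore ↥T) = 1 →
        ∀ t₀ : ↥T, IsRegularElt (((t₀ : Gqs L v)).val : GL (Fin 3) (UnitaryGroup.LocalRing L v)) →
        ∃ U : Set ↥T, IsOpen U ∧ t₀ ∈ U ∧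
        ∃ A₀ : Set (Gqs L v ⧸ T), MeasurableSet A₀ ∧
          quotientMeasure T tT hTcpt.isClosed ν A₀ ≠ 0 ∧ quotientMeasure T tT hTcpt.isClosed ν A₀ ≠ ∞ ∧
          ∀ V : Set ↥T, MeasurableSet V → V ⊆ U →
            (∀ t ∈ V, IsRegularElt (((t : Gqs L v)).val : GL (Fin 3) (UnitaryGroup.LocalRing L v))) →
            (∀ n : Gqs L v, n ∉ T → ∀ t ∈ V, ∀ t' ∈ V, ((t' : ↥T) : Gqs L v) ≠ n * t * n⁻¹) →
              ν {y : Gqs L v | ∃ (x : Gqs L v) (t : ↥T), (QuotientGroup.mk x : Gqs L v ⧸ T) ∈ A₀ ∧ t ∈ V ∧ y = x * t * x⁻¹} =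
                quotientMeasure T tT hTcpt.isClosed ν A₀ *
                  ∫⁻ t in V, ((NNReal.sqrt
                    ((∏ w : PlacesOver L v, Literature.NumberTheory.GaloisRepresentations.IsNonarchimedeanLocalField.normAbs (w.1.adicCompletion L)
                        ((((t : Gqs L v).val : GL (Fin 3) (UnitaryGroup.LocalRing L v)).val.charpoly.discr) w)) *
                      ((∏ w : PlacesOver L v, Literature.NumberTheory.GaloisRepresentations.IsNonarchimedeanLocalField.normAbs (w.1.adicCompletion L)
                        ((((t : Gqs L v).val : GL (Fin 3) (UnitaryGroup.LocalRing L v)).val.det) w)) ^ 2)⁻¹) : ℝ≥0) : ℝ≥0∞) ∂tT) := by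
  intro T γ₀ hγ₀ hT hTcpt
  letI : MeasurableSpace (Gqs L v ⧸ T) := borel _
  haveI : BorelSpace (Gqs L v ⧸ T) := ⟨rfl⟩
  intro tT _ _ _ t₀ ht₀
  -- ### the place `w ∣ v` (non-split: fixed by `c̄`)
  obtain ⟨w⟩ := (inferInstance : Nonempty (PlacesOver L v))
  -- ### the conjugation family of the abelian `T = Z(γ₀)`
  have hab : ∀ a ∈ T, ∀ b ∈ T, a * b = b * a := by
    intro a ha b hb
    rw [hT] at ha hb
    exact mul_comm_of_mem_centralizer L v hγ₀ a ha b hb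
  obtain ⟨Φ, hΦ⟩ := exists_conjFamily T hab
  -- ### ★ WEIGHT-DOCK 2∕2 at `(ν, tT)`, weight the letter (`hD := rfl`)
  obtain ⟨U, hUo, ht₀U, A₀, hA₀m, hA₀0, hA₀top, hJ⟩ :=
    tubeJacobianLocal_cartan_Gqs_elliptic L v w (hns w) hT hγ₀ hTcpt Φ hΦ hTcpt.isClosed ν tT
      (fun t : ↥T => NNReal.sqrt
        ((∏ w : PlacesOver L v, Literature.NumberTheory.GaloisRepresentations.IsNonarchimedeanLocalField.normAbs (w.1.adicCompletion L)
            ((((t : Gqs L v).val : GL (Fin 3) (UnitaryGroup.LocalRing L v)).val.charpoly.discr) w)) *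
          ((∏ w : PlacesOver L v, Literature.NumberTheory.GaloisRepresentations.IsNonarchimedeanLocalField.normAbs (w.1.adicCompletion L)
            ((((t : Gqs L v).val : GL (Fin 3) (UnitaryGroup.LocalRing L v)).val.det) w)) ^ 2)⁻¹))
      (fun _ => rfl) t₀ ht₀
  refine ⟨U, hUo, ht₀U, A₀, hA₀m, hA₀0, hA₀top, fun V hVm hVU hVreg hVW => ?_⟩
  -- ### the tube IS `Φ '' (A₀ ×ˢ V)`
  have htube : {y : Gqs L v | ∃ (x : Gqs L v) (t : ↥T), (QuotientGroup.mk x : Gqs L v ⧸ T) ∈ A₀ ∧ t ∈ V ∧ y = x * t * x⁻¹} = Φ '' (A₀ ×ˢ V) := by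
    ext y
    constructor
    · rintro ⟨x, t, hx, ht, rfl⟩
      exact ⟨(QuotientGroup.mk x, t), ⟨hx, ht⟩, hΦ x t⟩
    · rintro ⟨⟨q, t⟩, ⟨hq, ht⟩, rfl⟩
      obtain ⟨x, rfl⟩ := QuotientGroup.mk_surjective q
      exact ⟨x, t, hq, ht, hΦ x t⟩
  rw [htube]
  exact hJ V hVm hVU hVreg hVW

end CM

end Summit.HodgeConjecture.HodgeConjecture.Cruxes.H413.F0P3cStCharTSJacCartanTerminus

end
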